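import Mathlib
import Summits.ValiantsHypothesis.ValiantsHypothesis.Theorems.LacunarySymmetroidMatrixDescartesDefiniteMomentsDescartes
import Literature.Algebra.Polynomial.LacunaryBivariateOnLine

/-!
# `MatrixDescartes` (stmt-ValiantsHypothesis-18050) — the DEFINITE-MOMENTS LAW, X: Rayleigh-sharp pencils are
# alternating DEFINITE words (the intrinsic hyperbolic sector lies inside Cameron–Psarrakos' class 𝓗)

HONEST FRAMING.  Cell `pub-symmetroid`, seat `val-sym-mdr-p2` (gen 14); helper file `--supports` the crux
`Theses.LacunarySymmetroid.MatrixDescartes`, NO closure claim.  A structural lemma about the SCOPE of the definite-moments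
law (`…DefiniteMomentsDescartes.card_posRoots_le_of_alternatingMoments`): nothing here bears on the crux in its window, on
`stub_twoSided`, on `DoorA26`/`DoorA34`, registers, or `VP ≠ VNP`.

CONTENT.  `F(x) = ∑ₗ x^{dₗ} Sₗ` with `K ≥ 2` real symmetric letters at STRICTLY increasing exponents.  Call `F`
RAYLEIGH-SHARP if every Rayleigh `K`-nomial `p_v = ∑ₗ (vᵀSₗv) X^{dₗ}` (`v ≠ 0`) has `K − 1` distinct positive zeros
(Descartes' maximum).  THEOREM (`alternatingDefinite_of_rayleighSharp`): a Rayleigh-sharp pencil has every letter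
DEFINITE, with signs alternating along the exponents — `σ·(−1)^l·vᵀSₗv > 0` for all `v ≠ 0` and one global sign `σ`.
(Descartes: `K − 1` positive zeros need `K − 1` sign variations, i.e. all `K` coefficients non-zero (`ne_zero_of_rayleighSharp`)
and consecutive ones of opposite signs (`signVariations_lacunary` = exact count of sign changes of a lacunary coefficient
sequence, from the tree's `Literature.Algebra.Polynomial.signVariations_C_mul_X_pow_add`); a quadratic form vanishing at no
non-zero vector is definite (`sameSign_of_ne_zero`, intermediate value theorem on a segment).)  So the INTRINSIC hyperbolic
sector («Rayleigh-sharp with separated zones») is contained in the lacunary version of Cameron–Psarrakos' class 𝓗 of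
definite-coefficient hyperbolic polynomials, and the K alternating definite scales of Theorem C can only exist for
alternating definite words (which the tree's `cameronPsarrakos_counterexample` shows is NOT sufficient: 6 > 4 at (2,3)).
[folklore]; axioms `propext`, `Classical.choice`, `Quot.sound`; no definitions.
-/

-- layout Summits/ValiantsHypothesis/ValiantsHypothesis forces the duplicated namespace component
set_option linter.dupNamespace false

namespace Summit.ValiantsHypothesis.ValiantsHypothesis.Theorems.LacunarySymmetroidMatrixDescartes

open Polynomial Matrix Finset
open scoped BigOperators

namespace DefiniteMoments

/-! ## §1 Sign variations of a lacunary polynomial with non-zero coefficients -/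

/-- **Exact sign-variation count of a lacunary polynomial.**  For non-zero coefficients `c₀, …, c_{K−1}` at strictly
increasing exponents `d₀ < ⋯ < d_{K−1}` (`K ≥ 1`), the polynomial `∑_{i<K} cᵢ X^{dᵢ}` is non-zero with leading coefficient
`c_{K−1}`, degree `d_{K−1}`, and `Var = #{i < K−1 : sign cᵢ₊₁ ≠ sign cᵢ}`. [folklore] -/
theorem signVariations_lacunary (c : ℕ → ℝ) (d : ℕ → ℕ) :
    ∀ K : ℕ, (∀ i, i < K + 1 → c i ≠ 0) → (∀ i, i + 1 < K + 1 → d i < d (i + 1)) →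
      (∑ i ∈ Finset.range (K + 1), C (c i) * (X : ℝ[X]) ^ d i) ≠ 0 ∧
      (∑ i ∈ Finset.range (K + 1), C (c i) * (X : ℝ[X]) ^ d i).natDegree = d K ∧
      (∑ i ∈ Finset.range (K + 1), C (c i) * (X : ℝ[X]) ^ d i).leadingCoeff = c K ∧
      (∑ i ∈ Finset.range (K + 1), C (c i) * (X : ℝ[X]) ^ d i).signVariations
        = ((Finset.range K).filter (fun i => SignType.sign (c (i + 1)) ≠ SignType.sign (c i))).card := by
  intro K
  induction K with
  | zero =>
    intro hc _
    have h0 : c 0 ≠ 0 := hc 0 (by omega)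
    refine ⟨?_, ?_, ?_, ?_⟩
    · rw [Finset.sum_range_one]; exact mul_ne_zero (C_ne_zero.2 h0) (pow_ne_zero _ X_ne_zero)
    · rw [Finset.sum_range_one, natDegree_C_mul_X_pow _ _ h0]
    · rw [Finset.sum_range_one, leadingCoeff_C_mul_X_pow]
    · rw [Finset.sum_range_one, Finset.range_zero, Finset.filter_empty, Finset.card_empty,
        Polynomial.C_mul_X_pow_eq_monomial, signVariations_monomial]
  | succ K ih =>
    intro hc hd
    obtain ⟨hne, hdeg, hlc, hsv⟩ := ih (fun i hi => hc i (by omega)) (fun i hi => hd i (by omega))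
    set P := ∑ i ∈ Finset.range (K + 1), C (c i) * (X : ℝ[X]) ^ d i with hP
    have hcK : c (K + 1) ≠ 0 := hc (K + 1) (by omega)
    have hdK : d K < d (K + 1) := hd K (by omega)
    have hPdeg : P.degree < d (K + 1) := by
      rw [Polynomial.degree_eq_natDegree hne, hdeg]
      exact_mod_cast hdK
    have hsum : ∑ i ∈ Finset.range (K + 1 + 1), C (c i) * (X : ℝ[X]) ^ d i = C (c (K + 1)) * X ^ d (K + 1) + P := by
      rw [Finset.sum_range_succ, add_comm]
    have hdeg' : P.degree < (C (c (K + 1)) * (X : ℝ[X]) ^ d (K + 1)).degree := by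
      rwa [degree_C_mul_X_pow _ hcK]
    rw [hsum]
    refine ⟨?_, ?_, ?_, ?_⟩
    · intro h
      have h1 := congrArg Polynomial.leadingCoeff h
      rw [leadingCoeff_add_of_degree_lt' hdeg', leadingCoeff_C_mul_X_pow, leadingCoeff_zero] at h1
      exact hcK h1
    · rw [natDegree_add_eq_left_of_degree_lt hdeg', natDegree_C_mul_X_pow _ _ hcK]
    · rw [leadingCoeff_add_of_degree_lt' hdeg', leadingCoeff_C_mul_X_pow]
    · rw [Literature.Algebra.Polynomial.signVariations_C_mul_X_pow_add hcK hPdeg, hsv, hlc, Finset.range_add_one,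
        Finset.filter_insert]
      have hKnot : K ∉ (Finset.range K).filter (fun i => SignType.sign (c (i + 1)) ≠ SignType.sign (c i)) := by
        simp
      have hcK' : c K ≠ 0 := hc K (by omega)
      by_cases h : SignType.sign (c (K + 1)) ≠ SignType.sign (c K)
      · -- for non-zero reals, different signs means opposite signs
        have hopp : SignType.sign (c (K + 1)) = -SignType.sign (c K) := by
          rcases lt_or_gt_of_ne hcK with h1 | h1 <;> rcases lt_or_gt_of_ne hcK' with h2 | h2
          · exact absurd (by rw [sign_neg h1, sign_neg h2]) h
          · rw [sign_neg h1, sign_pos h2]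
          · rw [sign_pos h1, sign_neg h2]; decide
          · exact absurd (by rw [sign_pos h1, sign_pos h2]) h
        rw [if_pos h, Finset.card_insert_of_notMem hKnot, if_pos hopp]
      · have hsame : ¬ (SignType.sign (c (K + 1)) = -SignType.sign (c K)) := by
          push Not at h
          rw [h]
          rcases lt_or_gt_of_ne hcK' with h2 | h2
          · rw [sign_neg h2]; decide
          · rw [sign_pos h2]; decide
        rw [if_neg h, if_neg hsame, add_zero]

/-! ## §2 Rayleigh-sharp pencils -/

section Sharp

variable {ι : Type} [Fintype ι]

/-- A real quadratic form that vanishes at no non-zero vector has the same strict sign at any two non-zero vectors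
(intermediate value theorem along the segment, which avoids the origin unless the vectors are negatively proportional —
and then the values have the same sign anyway). [folklore] -/
theorem sameSign_of_ne_zero (A : Matrix ι ι ℝ) (hA : ∀ v : ι → ℝ, v ≠ 0 → v ⬝ᵥ (A *ᵥ v) ≠ 0) (v w : ι → ℝ)
    (hv : v ≠ 0) (hw : w ≠ 0) : 0 < (v ⬝ᵥ (A *ᵥ v)) * (w ⬝ᵥ (A *ᵥ w)) := by
  by_contra hle
  push Not at hle
  rcases hle.lt_or_eq with hlt | heq
  · -- opposite signs: walk along the segment `u(s) = (1−s)v + s w`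
    set q : ℝ → ℝ := fun s => ((1 - s) • v + s • w) ⬝ᵥ (A *ᵥ ((1 - s) • v + s • w)) with hq
    have hqc : Continuous q := by
      have h1 : Continuous fun s : ℝ => (1 - s) • v + s • w := by fun_prop
      exact Continuous.dotProduct h1 ((continuous_const.matrix_mulVec h1))
    have hq0 : q 0 = v ⬝ᵥ (A *ᵥ v) := by simp [hq]
    have hq1 : q 1 = w ⬝ᵥ (A *ᵥ w) := by simp [hq]
    -- a zero of `q` on `[0,1]`
    obtain ⟨s, hs, hqs⟩ : ∃ s ∈ Set.Icc (0 : ℝ) 1, q s = 0 := by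
      rcases mul_neg_iff.1 hlt with h | h
      · obtain ⟨s, hs, hqs⟩ : (0 : ℝ) ∈ q '' Set.Icc 0 1 :=
          intermediate_value_Icc' zero_le_one hqc.continuousOn ⟨by rw [hq1]; exact h.2.le, by rw [hq0]; exact h.1.le⟩
        exact ⟨s, hs, hqs⟩
      · obtain ⟨s, hs, hqs⟩ : (0 : ℝ) ∈ q '' Set.Icc 0 1 :=
          intermediate_value_Icc zero_le_one hqc.continuousOn ⟨by rw [hq0]; exact h.1.le, by rw [hq1]; exact h.2.le⟩
        exact ⟨s, hs, hqs⟩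
    -- the point `u(s)` is non-zero: otherwise `v` and `w` are positively... proportional with a sign making the
    -- two values share a sign
    have hu : (1 - s) • v + s • w ≠ 0 := by
      intro hu0
      have hs0 : s ≠ 0 := by rintro rfl; simp at hu0; exact hv hu0
      have hs1 : s ≠ 1 := by rintro rfl; simp at hu0; exact hw hu0
      -- `w = -((1-s)/s) • v` with `(1-s)/s > 0`, so the two values are positive multiples of each other
      have hw' : w = (-((1 - s) / s)) • v := by
        have h1 : s • w = -((1 - s) • v) := eq_neg_of_add_eq_zero_right hu0
        have h2 : w = s⁻¹ • (s • w) := by rw [smul_smul, inv_mul_cancel₀ hs0, one_smul]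
        rw [h2, h1, smul_neg, smul_smul, neg_smul, div_eq_inv_mul]
      have hval : w ⬝ᵥ (A *ᵥ w) = ((1 - s) / s) ^ 2 * (v ⬝ᵥ (A *ᵥ v)) := by
        rw [hw', Matrix.mulVec_smul, dotProduct_smul, smul_dotProduct, smul_eq_mul, smul_eq_mul]; ring
      have hpos : 0 < ((1 - s) / s) ^ 2 := by
        have : (1 - s) / s ≠ 0 := div_ne_zero (sub_ne_zero.2 (Ne.symm hs1)) hs0
        positivity
      rw [hval] at hlt
      have hvv : v ⬝ᵥ (A *ᵥ v) ≠ 0 := hA v hv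
      nlinarith [mul_pos hpos (mul_self_pos.2 hvv)]
    exact hA _ hu hqs
  · rcases mul_eq_zero.1 heq with h | h
    · exact hA v hv h
    · exact hA w hw h

/-- **Rayleigh-sharp ⇒ every Rayleigh coefficient is non-zero.**  If `K ≥ 2` letters sit at strictly increasing exponents
and every Rayleigh `K`-nomial (`v ≠ 0`) has at least `K − 1` distinct positive zeros, then `vᵀSₗv ≠ 0` for all `v ≠ 0`
and all `l` (a vanishing coefficient would leave at most `K − 1` monomials, hence at most `K − 2` positive zeros). [folklore] -/
theorem ne_zero_of_rayleighSharp {K : ℕ} (hK : 2 ≤ K) (d : Fin K → ℕ) (S : Fin K → Matrix ι ι ℝ)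
    (hsharp : ∀ v : ι → ℝ, v ≠ 0 →
      K ≤ ((∑ l, C (v ⬝ᵥ (S l *ᵥ v)) * (X : ℝ[X]) ^ d l).roots.toFinset.filter (fun t => 0 < t)).card + 1)
    (v : ι → ℝ) (hv : v ≠ 0) (l : Fin K) : v ⬝ᵥ (S l *ᵥ v) ≠ 0 := by
  intro h0
  have hcard := hsharp v hv
  set P := ∑ l, C (v ⬝ᵥ (S l *ᵥ v)) * (X : ℝ[X]) ^ d l with hP
  by_cases hP0 : P = 0
  · rw [hP0, Polynomial.roots_zero] at hcard
    simp at hcard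
    omega
  · have h1 := Literature.Computability.AlgebraicComplexity.card_roots_toFinset_filter_pos_lt_card_support hP0
    have h2 : P.support.card ≤ K - 1 := by
      refine (Literature.Computability.AlgebraicComplexity.card_support_sum_le _ _).trans ?_
      have hl : (C (v ⬝ᵥ (S l *ᵥ v)) * (X : ℝ[X]) ^ d l).support.card = 0 := by
        rw [h0, map_zero, zero_mul, Polynomial.support_zero, Finset.card_empty]
      calc ∑ k, (C (v ⬝ᵥ (S k *ᵥ v)) * (X : ℝ[X]) ^ d k).support.card
          = ∑ k ∈ Finset.univ.erase l, (C (v ⬝ᵥ (S k *ᵥ v)) * (X : ℝ[X]) ^ d k).support.card := by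
            rw [← Finset.add_sum_erase _ _ (Finset.mem_univ l), hl, zero_add]
        _ ≤ ∑ _k ∈ Finset.univ.erase l, 1 := Finset.sum_le_sum fun k _ => Polynomial.card_support_C_mul_X_pow_le_one
        _ = K - 1 := by rw [Finset.sum_const, smul_eq_mul, mul_one, Finset.card_erase_of_mem (Finset.mem_univ l),
            Finset.card_univ, Fintype.card_fin]
    omega

/-- **RAYLEIGH-SHARP PENCILS ARE ALTERNATING DEFINITE WORDS.**  `K ≥ 2` real symmetric letters at strictly increasing
exponents; if every Rayleigh `K`-nomial `∑ₗ (vᵀSₗv) X^{dₗ}` (`v ≠ 0`) has at least `K − 1` distinct positive zeros, then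
there is one sign `σ = ±1` with `σ·(−1)^l·vᵀSₗv > 0` for every `l` and every `v ≠ 0`: all letters are definite and their
signs alternate along the exponents. [folklore] -/
theorem alternatingDefinite_of_rayleighSharp {K : ℕ} (hK : 2 ≤ K) (d : Fin K → ℕ) (hd : StrictMono d)
    (S : Fin K → Matrix ι ι ℝ)
    (hsharp : ∀ v : ι → ℝ, v ≠ 0 →
      K ≤ ((∑ l, C (v ⬝ᵥ (S l *ᵥ v)) * (X : ℝ[X]) ^ d l).roots.toFinset.filter (fun t => 0 < t)).card + 1)
    (v₀ : ι → ℝ) (hv₀ : v₀ ≠ 0) :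
    ∃ σ : ℝ, (σ = 1 ∨ σ = -1) ∧
      ∀ (l : Fin K) (v : ι → ℝ), v ≠ 0 → 0 < σ * (-1) ^ (l : ℕ) * (v ⬝ᵥ (S l *ᵥ v)) := by
  have hne := ne_zero_of_rayleighSharp hK d S hsharp
  -- consecutive coefficients of each Rayleigh K-nomial have opposite signs
  have halt : ∀ (v : ι → ℝ), v ≠ 0 → ∀ (i : ℕ) (hi : i + 1 < K),
      SignType.sign (v ⬝ᵥ (S ⟨i + 1, hi⟩ *ᵥ v)) ≠ SignType.sign (v ⬝ᵥ (S ⟨i, by omega⟩ *ᵥ v)) := by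
    intro v hv
    -- transport to an ℕ-indexed lacunary sum
    set c : ℕ → ℝ := fun i => if h : i < K then v ⬝ᵥ (S ⟨i, h⟩ *ᵥ v) else 1 with hc
    set e : ℕ → ℕ := fun i => if h : i < K then d ⟨i, h⟩ else d ⟨K - 1, by omega⟩ + (i + 1) with he
    have hcne : ∀ i, i < K - 1 + 1 → c i ≠ 0 := by
      intro i hi
      simp only [hc, dif_pos (show i < K by omega)]
      exact hne v hv _
    have hemono : ∀ i, i + 1 < K - 1 + 1 → e i < e (i + 1) := by
      intro i hi
      simp only [he, dif_pos (show i < K by omega), dif_pos (show i + 1 < K by omega)]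
      exact hd (Fin.mk_lt_mk.2 (by omega))
    obtain ⟨-, -, -, hsv⟩ := signVariations_lacunary c e (K - 1) hcne hemono
    have hsumeq : (∑ l, C (v ⬝ᵥ (S l *ᵥ v)) * (X : ℝ[X]) ^ d l)
        = ∑ i ∈ Finset.range (K - 1 + 1), C (c i) * (X : ℝ[X]) ^ e i := by
      rw [show K - 1 + 1 = K by omega, ← Fin.sum_univ_eq_sum_range (fun i => C (c i) * (X : ℝ[X]) ^ e i) K]
      refine Finset.sum_congr rfl fun l _ => ?_
      simp only [hc, he, dif_pos l.isLt]
    -- Descartes: K − 1 ≤ #positive zeros ≤ Var = #sign changes ≤ K − 1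
    have hroots := hsharp v hv
    rw [hsumeq] at hroots
    set P := ∑ i ∈ Finset.range (K - 1 + 1), C (c i) * (X : ℝ[X]) ^ e i with hP
    have hdesc : (P.roots.toFinset.filter (fun t => 0 < t)).card ≤ P.signVariations :=
      calc (P.roots.toFinset.filter (fun t => 0 < t)).card
          = (P.roots.filter (fun t => 0 < t)).toFinset.card := by rw [Multiset.toFinset_filter]
        _ ≤ (P.roots.filter (fun t => 0 < t)).card := Multiset.toFinset_card_le _
        _ = P.roots.countP (fun t => 0 < t) := (Multiset.countP_eq_card_filter _ _).symm
        _ ≤ P.signVariations := P.roots_countP_pos_le_signVariations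
    have hfilt : ((Finset.range (K - 1)).filter (fun i => SignType.sign (c (i + 1)) ≠ SignType.sign (c i))).card
        ≤ (Finset.range (K - 1)).card := Finset.card_filter_le _ _
    rw [Finset.card_range] at hfilt
    have hall : (Finset.range (K - 1)).filter (fun i => SignType.sign (c (i + 1)) ≠ SignType.sign (c i))
        = Finset.range (K - 1) := by
      apply Finset.eq_of_subset_of_card_le (Finset.filter_subset _ _)
      rw [Finset.card_range]
      omega
    intro i hi
    have hmem : i ∈ (Finset.range (K - 1)).filter (fun i => SignType.sign (c (i + 1)) ≠ SignType.sign (c i)) := by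
      rw [hall]; exact Finset.mem_range.2 (by omega)
    have h := (Finset.mem_filter.1 hmem).2
    simp only [hc, dif_pos (show i < K by omega), dif_pos hi] at h
    exact h
  -- global sign from the lowest letter at `v₀`
  have h00 : v₀ ⬝ᵥ (S ⟨0, by omega⟩ *ᵥ v₀) ≠ 0 := hne v₀ hv₀ _
  obtain ⟨σ, hσ, hσ0⟩ : ∃ σ : ℝ, (σ = 1 ∨ σ = -1) ∧ 0 < σ * (v₀ ⬝ᵥ (S ⟨0, by omega⟩ *ᵥ v₀)) := by
    rcases lt_or_gt_of_ne h00 with h | h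
    · exact ⟨-1, Or.inr rfl, by linarith⟩
    · exact ⟨1, Or.inl rfl, by linarith⟩
  refine ⟨σ, hσ, ?_⟩
  -- induction on the letter index, uniform in `v` by `sameSign_of_ne_zero`
  suffices key : ∀ (i : ℕ) (hi : i < K) (v : ι → ℝ), v ≠ 0 → 0 < σ * (-1) ^ i * (v ⬝ᵥ (S ⟨i, hi⟩ *ᵥ v)) from
    fun l v hv => key l l.isLt v hv
  intro i
  induction i with
  | zero =>
    intro hi v hv
    rw [pow_zero, mul_one]
    have hs := sameSign_of_ne_zero (S ⟨0, hi⟩) (fun u hu => hne u hu _) v₀ v hv₀ hv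
    rcases hσ with h | h <;> rw [h] at hσ0 ⊢ <;> nlinarith
  | succ i ih =>
    intro hi v hv
    have hprev := ih (by omega) v hv
    have hsgn := halt v hv i hi
    have ha : v ⬝ᵥ (S ⟨i + 1, hi⟩ *ᵥ v) ≠ 0 := hne v hv _
    have hb : v ⬝ᵥ (S ⟨i, by omega⟩ *ᵥ v) ≠ 0 := hne v hv _
    -- different signs of non-zero reals: their product is negative
    have hneg : v ⬝ᵥ (S ⟨i + 1, hi⟩ *ᵥ v) * (v ⬝ᵥ (S ⟨i, by omega⟩ *ᵥ v)) < 0 := by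
      rcases lt_or_gt_of_ne ha with h1 | h1 <;> rcases lt_or_gt_of_ne hb with h2 | h2
      · exact absurd (by rw [sign_neg h1, sign_neg h2]) hsgn
      · exact mul_neg_of_neg_of_pos h1 h2
      · exact mul_neg_of_pos_of_neg h1 h2
      · exact absurd (by rw [sign_pos h1, sign_pos h2]) hsgn
    rw [pow_succ]
    rcases hσ with h | h <;> rcases neg_one_pow_eq_or ℝ i with hp | hp <;> rw [h, hp] at hprev ⊢ <;> nlinarith

end Sharp

end DefiniteMoments

end Summit.ValiantsHypothesis.ValiantsHypothesis.Theorems.LacunarySymmetroidMatrixDescartes
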